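import Summits.Ventures.LatticeQCDFlow.Scaling.BooleanStarPoolDrift
import Summits.Ventures.LatticeQCDFlow.Scaling.BooleanStarPoolRegime

/-!
HONEST FRAMING: exact (Metropolis-corrected) sampling algorithms for lattice gauge theory; figures
of merit are autocorrelation/cost numbers at stated couplings and volumes; no continuum-physics
claim.

# BooleanStarMacroscopicPoolLaw — THE LAST CORNER OF OPEN-MATH ITEM 1 (ii) ON THE HOMOGENEOUS BOOLEAN STAR IS CLOSED: IN THE MACROSCOPIC-POOL REGIME
# `μ_1(b̄)·K ≥ μ_1(b)/2`, `rr ≤ μ_0(b)` THE COLD-START LAW IS `t_mix(ε) ≤ ⌈(4/(hρ))·log((3eK+1)/ε)⌉`, `ρ = μ_0(b)(t/K)/(96(h+2t))` — THE CONJECTURED ORDER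
# `K/(μ_0(b)·min{t,h})·log(K/ε)` FOR ALL `K` AND ALL `t/h` (lean-2 GEN-33, ours)

Venture-side (OURS).  Cell `lqcd-flow` (pub-lqcd), unit `pub-lqcd-lean-2-g33`, 2026-08-29.  Chapter T, file 3: the assembly of T1/T1b (the explicit relative-drift
potential passes S9's one-dimensional drift inequality given four closed-form conditions) with T2a/T2b (the conditions hold for the one-copy chain of the homogeneous
Boolean star in the regime) and S11 §3 (`boolStar_mixingTime_le_of_oneCopyDrift_int`: potentials given on the integers are admissible, by McShane).

* §1 `int_lipschitz_of_step` (unit-bounded non-negative increments ⇒ 1-Lipschitz on `ℤ`), **`oneCopyDrift_macroPool`** — for `h > 0`, `0 < c ≤ t = cK`,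
  `0 ≤ rr ≤ 1`, `μ_0(b) > 0`, `μ_0(b̄) ≥ 0`, `μ_0(b) + μ_0(b̄) = 1`, **`rr ≤ μ_0(b)`** and **`μ_0(b̄)·rr·K ≥ μ_0(b)/2`**, THERE IS a potential `φ : ℝ → ℝ`, `≥ 0` and
  1-Lipschitz on the integers, `φ(n) ≤ K` on `[0, K]`, satisfying the drift inequality `h1D` of S9 with **`ρ = μ_0(b)c/(96(h+2t))`** — namely
  `φ(x) = Σ_{B₀ ≤ j < ⌊x⌋} S(j)` with the relative-drift slopes `S(j) = (1/6)(1 − q↑(j+1)/q↓(j+1))` of T1 above the bottom `B₀` of the drift (T2a `pool_bottom_exists`).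
* §2 **`boolStar_mixingTime_le_macroPool`** — homogeneous Boolean star (`m ≥ 1` uniform entries, `0 < t < 1`, `w_0 > 0`, positive laws, idle cold levels, exact hot
  redraws), liked content `b`, `rr = μ_0(b)μ_1(b̄)/(μ_0(b̄)μ_1(b)) ≤ μ_0(b)`, `μ_0(b̄)·rr·K ≥ μ_0(b)/2`:
  **`t_mix(ε) ≤ ⌈(4/(hρ))·log((3eK+1)/ε)⌉₊`, `ρ = μ_0(b)(t/K)/(96(h+2t))`**, `h = (1−t)w_0`.

Together with T0 (`φ ≡ 0`: every law, rate `c(ph+rr t)/(h+2t)²`, of the conjectured order whenever `rr ≥ μ_0(b)`; `φ = B`: small pool `μ_0(b̄)rrK ≤ μ_0(b)/2`) this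
covers EVERY law, every `K` and every `t/h`; the three legs are combined into one unconditional statement in T4.  Toy value of the same potential
(work-gen33/numerics/explicit_potential.py; NOTHING CLAIMED): `κ ≥ 0.75` in units `μ_0(b)c/(h+2t)` versus the certified `1/96`.
NOT CLAIMED: anything measured; optimal constants.  Literature grade (cell rule): OWN, elementary; nothing cited as a fact; no new bib keys.
-/

noncomputable section

namespace Summit.Ventures.LatticeQCDFlow.Scaling

open Finset

/-! ## §1 The potential on the integers and its drift inequality in the macroscopic-pool regime -/

/-- A function on `ℤ` with increments in `[0, 1]` is non-decreasing and `1`-Lipschitz. [ours] -/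
theorem int_lipschitz_of_step {f : ℤ → ℝ} (hf : ∀ n, 0 ≤ f (n + 1) - f n ∧ f (n + 1) - f n ≤ 1) (n n' : ℤ) :
    |f n - f n'| ≤ |(n : ℝ) - n'| := by
  -- monotone with bounded increments along `k` steps
  have up : ∀ (a : ℤ) (k : ℕ), 0 ≤ f (a + k) - f a ∧ f (a + k) - f a ≤ k := by
    intro a k
    induction k with
    | zero => simp
    | succ j ih =>
      have h1 := hf (a + j)
      push_cast
      rw [show a + ((j : ℤ) + 1) = a + j + 1 by ring]
      constructor <;> linarith [ih.1, ih.2, h1.1, h1.2]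
  rcases le_or_gt n n' with h | h
  · obtain ⟨k, rfl⟩ : ∃ k : ℕ, n' = n + k := ⟨(n' - n).toNat, by rw [Int.toNat_of_nonneg (by linarith)]; ring⟩
    have := up n k
    push_cast
    rw [abs_of_nonpos (by linarith [this.1]), abs_of_nonpos (by linarith : (n : ℝ) - (n + k) ≤ 0)]
    linarith [this.2]
  · obtain ⟨k, rfl⟩ : ∃ k : ℕ, n = n' + k := ⟨(n - n').toNat, by rw [Int.toNat_of_nonneg (by linarith)]; ring⟩
    have := up n' k
    push_cast
    rw [abs_of_nonneg (by linarith [this.1]), abs_of_nonneg (by linarith : (0 : ℝ) ≤ (n' : ℝ) + k - n')]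
    linarith [this.2]

/-- **THE DRIFT INEQUALITY IN THE MACROSCOPIC-POOL REGIME, WITH AN EXPLICIT ADMISSIBLE POTENTIAL.**  For `h > 0`, `0 < c ≤ t = cK` (`K ≥ 1`), `0 ≤ rr ≤ 1`,
`μ_0(b) > 0`, `μ_0(b̄) ≥ 0`, `μ_0(b) + μ_0(b̄) = 1`, `rr ≤ μ_0(b)`, `μ_0(b̄)·rr·K ≥ μ_0(b)/2`: there is `φ : ℝ → ℝ` with `φ(n) ≥ 0` and `|φ(n) − φ(n')| ≤ |n − n'|` for
integers `n, n'`, `φ(n) ≤ K` for naturals `n ≤ K`, such that for all naturals `B₁ < B₂ ≤ K`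
`ρ(B₂ − B₁ + φ(B₁) + φ(B₂)) ≤ μ_0(b)[π_b(B₂) − π_b(B₁)] + μ_0(b̄)[π_b̄(B₁) − π_b̄(B₂)] + d(B₁) + d(B₂)` with **`ρ = μ_0(b)c/(96(h+2t))`** — the potential of T1 (relative-drift
slopes `(1/6)(1 − q↑(j+1)/q↓(j+1))` above the bottom `B₀` of the one-copy drift, summed from `B₀` to `⌊x⌋`), through `oneCopyDrift_of_relativeDriftPotential` (T1b) and the
closed-form estimates of T2a/T2b. [ours] -/
theorem oneCopyDrift_macroPool {h c t rr μb μb' : ℝ} {K : ℕ} (hh : 0 < h) (hc : 0 < c) (hct : c ≤ t) (htK : t = c * K) (hK : 1 ≤ K)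
    (hrr0 : 0 ≤ rr) (hrr1 : rr ≤ 1) (hμb : 0 < μb) (hμb' : 0 ≤ μb') (hsum : μb + μb' = 1) (hrrμ : rr ≤ μb) (hpool : μb / 2 ≤ μb' * rr * K)
    {πb πb' : ℝ → ℝ} (hπb : ∀ B, πb B = c * B / (h + c * B + c * rr * (K - B + 1)))
    (hπb' : ∀ B, πb' B = c * (K - B) * rr / (h + c * (K - B) * rr + c * (B + 1))) :
    ∃ φ : ℝ → ℝ, (∀ n : ℤ, 0 ≤ φ n) ∧ (∀ n n' : ℤ, |φ n - φ n'| ≤ |(n : ℝ) - n'|) ∧ (∀ n : ℕ, n ≤ K → φ n ≤ K) ∧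
      ∀ B₁ B₂ : ℕ, B₁ + 1 ≤ B₂ → B₂ ≤ K →
        μb * c / (96 * (h + 2 * t)) * ((B₂ : ℝ) - B₁ + φ B₁ + φ B₂) ≤ μb * (πb B₂ - πb B₁) + μb' * (πb' B₁ - πb' B₂)
          + (μb * πb B₁ * (φ B₁ - φ (B₁ - 1)) - μb' * πb' B₁ * (φ (B₁ + 1) - φ B₁))
          + (μb * πb B₂ * (φ B₂ - φ (B₂ - 1)) - μb' * πb' B₂ * (φ (B₂ + 1) - φ B₂)) := by
  -- the one-copy chain on the integers
  set qd : ℤ → ℝ := fun z => μb * (c * z / (h + c * z + c * rr * ((K : ℝ) - z + 1))) with hqd_def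
  set qu : ℤ → ℝ := fun z => μb' * (c * ((K : ℝ) - z) * rr / (h + c * ((K : ℝ) - z) * rr + c * (z + 1))) with hqu_def
  set m : ℤ → ℝ := fun z => qu z - qd z with hm_def
  have hqd : ∀ z : ℤ, qd z = μb * (c * z / (h + c * z + c * rr * ((K : ℝ) - z + 1))) := fun z => rfl
  have hqu : ∀ z : ℤ, qu z = μb' * (c * ((K : ℝ) - z) * rr / (h + c * ((K : ℝ) - z) * rr + c * (z + 1))) := fun z => rfl
  have hm : ∀ z, m z = qu z - qd z := fun z => rfl
  have hμb'1 : μb' ≤ 1 := by linarith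
  -- the bottom of the drift
  obtain ⟨B₀, hB0, hB0K, hmB0, hmB1, hB0W⟩ := pool_bottom_exists hh hc hrr0 hrr1 hμb hμb' hK hqd hqu hm
  -- the slopes and the potential on the integers
  set Sz : ℤ → ℝ := fun j => if j < B₀ then 0 else if j + 1 ≤ (K : ℤ) then (1 / 6 : ℝ) * (1 - qu (j + 1) / qd (j + 1)) else 1 / 6 with hSz
  set φz : ℤ → ℝ := fun n => ∑ i ∈ range (n - B₀).toNat, Sz (B₀ + i) with hφz
  have hSlo : ∀ j, j < B₀ → Sz j = 0 := fun j hj => by simp only [hSz]; rw [if_pos hj]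
  have hSmid : ∀ j, B₀ ≤ j → j + 1 ≤ (K : ℤ) → Sz j = 1 / 6 * (1 - qu (j + 1) / qd (j + 1)) := fun j hj hjK => by
    simp only [hSz]; rw [if_neg (not_lt.mpr hj), if_pos hjK]
  have hShi : ∀ j, (K : ℤ) ≤ j → Sz j = 1 / 6 := fun j hj => by
    have h1 : ¬ j < B₀ := not_lt.mpr (by linarith)
    have h2 : ¬ j + 1 ≤ (K : ℤ) := not_le.mpr (by linarith)
    simp only [hSz]; rw [if_neg h1, if_neg h2]
  have hφ0 : φz B₀ = 0 := by simp [hφz]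
  have hφS : ∀ n, φz (n + 1) - φz n = Sz n := by
    intro n
    rcases lt_or_ge n B₀ with hn | hn
    · have e1 : (n + 1 - B₀).toNat = 0 := by omega
      have e2 : (n - B₀).toNat = 0 := by omega
      simp only [hφz, e1, e2, sum_range_zero, sub_self]
      exact (hSlo n hn).symm
    · have e1 : (n + 1 - B₀).toNat = (n - B₀).toNat + 1 := by omega
      simp only [hφz, e1, sum_range_succ]
      have : B₀ + ((n - B₀).toNat : ℤ) = n := by rw [Int.toNat_of_nonneg (by linarith)]; ring
      rw [this]; ring
  -- chain facts (T2a) and the regime facts (T2b)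
  have hqdpos := pool_qd_pos hh hc hrr0 hμb hqd
  have hqu0 := pool_qu_nonneg hh hc hrr0 hμb' hqu
  have hqdmono := pool_qd_mono hh hc hrr0 hμb hqd
  have hqd2 := pool_qd_two hh hc hrr0 hrr1 hμb hqd
  have hqumono := pool_qu_anti hh hc hrr0 hμb' hqu
  have hquK := pool_qu_top (K := K) hqu
  have hg0 := pool_gap_nonneg hh hc hrr0 hμb hμb' hqd hqu hm
  have hga := pool_gap_anti hh hc hrr0 hrr1 hμb hμb' hqd hqu hm
  have Q0 : 1 / 6 * qu B₀ ≤ qd (B₀ + 1) / 2 := pool_Q0 hh hc hrr0 hμb hμb'1 hrrμ hqd hqu hm hB0 hB0K hmB1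
  obtain ⟨Bp, hBp⟩ : ∃ Bp : ℤ, Bp = ⌊2 * μb' * rr * K / μb⌋ := ⟨_, rfl⟩
  have hB0Bp : B₀ ≤ Bp := by
    rw [hBp, Int.le_floor, le_div_iff₀ hμb]
    have : 0 ≤ μb' * rr * (K : ℝ) := by positivity
    linarith [hB0W]
  have Q2a : ∀ B, B₀ ≤ B → B ≤ Bp → B + 1 ≤ (K : ℤ) → 8 * (μb * c / (96 * (h + 2 * t))) ≤ m B - m (B + 1) := by
    intro B hB hBp' hBK
    have hBW : (B : ℝ) ≤ 2 * μb' * rr * K / μb := by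
      have h1 : ((B : ℤ) : ℝ) ≤ ((Bp : ℤ) : ℝ) := Int.cast_le.mpr hBp'
      rw [hBp] at h1
      exact le_trans h1 (Int.floor_le _)
    exact pool_Q2a hh hc hct htK hrr0 hrr1 hμb hμb' hsum hpool hqd hqu hm B (by linarith) hBW hBK
  have Q2b : ∀ B, Bp + 1 ≤ B → B + 1 ≤ (K : ℤ) → 2 * (μb * c / (96 * (h + 2 * t))) * B * qd (B + 1) ≤ 1 / 6 * (-m B) * (qd (B + 1) - qu B) := by
    intro B hB hBK
    have hBW : 2 * μb' * rr * K / μb < (B : ℝ) := by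
      have h1 := Int.lt_floor_add_one (2 * μb' * rr * K / μb)
      have h2 : ((Bp + 1 : ℤ) : ℝ) ≤ B := by exact_mod_cast hB
      push_cast at h2; rw [hBp] at h2; linarith
    have hB1 : 1 ≤ B := by
      have : 0 ≤ Bp := le_trans hB0 hB0Bp
      linarith
    exact pool_Q2b hh hc hct htK hrr0 hrr1 hμb hμb' hqd hqu hm B hB1 hBW hBK
  have Q2c : Bp + 1 ≤ (K : ℤ) → 2 * (μb * c / (96 * (h + 2 * t))) * ((K : ℤ) : ℝ) ≤ 1 / 6 * (-m K) := fun _ => by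
    have := pool_Q2c hh hc hct htK hrr0 hrr1 hμb hqd hqu hm; push_cast at this ⊢; exact this
  -- the shape of the potential (T1)
  have ht0 : 0 < t := lt_of_lt_of_le hc hct
  have hρ : 0 ≤ μb * c / (96 * (h + 2 * t)) := by positivity
  have mK : ∀ B B', 0 ≤ B → B ≤ B' → B' ≤ (K : ℤ) → m B' ≤ m B := fun B B' h0 hBB' hK' =>
    int_chain_le (f := m) (lo := 0) (hi := K - 1) (fun X hX hX' => hg0 X hX (by linarith)) h0 hBB' (by linarith)
  have hle : ∀ B, B₀ + 1 ≤ B → B ≤ (K : ℤ) → qu B ≤ qd B := fun B hB hBK => by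
    have := lt_of_le_of_lt (mK (B₀ + 1) B (by linarith) hB hBK) hmB1; rw [hm] at this; linarith
  obtain ⟨low, rng, -, phi⟩ := relDrift_phi (by norm_num : (0 : ℝ) ≤ 1 / 6) hqdpos hqu0 hqdmono hqumono hB0 hB0K hle hSlo hSmid hφS hφ0
  -- increments in `[0, 1]` everywhere, hence `1`-Lipschitz and non-negative
  have step : ∀ n, 0 ≤ φz (n + 1) - φz n ∧ φz (n + 1) - φz n ≤ 1 := by
    intro n
    rw [hφS n]
    rcases lt_or_ge n B₀ with hn | hn
    · rw [hSlo n hn]; norm_num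
    rcases le_or_gt (n + 1) (K : ℤ) with hnK | hnK
    · obtain ⟨s0, s1⟩ := rng n hn hnK; exact ⟨s0, by linarith⟩
    · rw [hShi n (by linarith)]; norm_num
  have lip := int_lipschitz_of_step step
  have mono : ∀ (a : ℤ) (k : ℕ), φz a ≤ φz (a + k) := by
    intro a k
    induction k with
    | zero => simp
    | succ j ih =>
      have := (step (a + j)).1
      push_cast; rw [show a + ((j : ℤ) + 1) = a + j + 1 by ring]; linarith
  have nonneg : ∀ n : ℤ, 0 ≤ φz n := by
    intro n
    rcases le_or_gt n B₀ with hn | hn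
    · rw [low n hn]
    · obtain ⟨k, rfl⟩ : ∃ k : ℕ, n = B₀ + k := ⟨(n - B₀).toNat, by rw [Int.toNat_of_nonneg (by linarith)]; ring⟩
      have := mono B₀ k; rw [hφ0] at this; exact this
  have bound : ∀ n : ℕ, n ≤ K → φz n ≤ K := by
    intro n hn
    rcases le_or_gt (n : ℤ) B₀ with h1 | h1
    · rw [low n h1]; positivity
    · obtain ⟨-, f1, -⟩ := phi n (by linarith) (by exact_mod_cast hn)
      have hB0r : (0 : ℝ) ≤ B₀ := by exact_mod_cast hB0
      have hnK : (n : ℝ) ≤ K := by exact_mod_cast hn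
      have : 1 / 6 * (((n : ℤ) : ℝ) - B₀) ≤ (n : ℝ) := by
        push_cast
        have : (0 : ℝ) ≤ (n : ℝ) - B₀ := by
          have : ((B₀ : ℝ) < ((n : ℤ) : ℝ)) := by exact_mod_cast h1
          push_cast at this; linarith
        linarith
      linarith
  refine ⟨fun x => φz ⌊x⌋, fun n => by simpa using nonneg n, fun n n' => by simpa using lip n n', fun n hn => by simpa using bound n hn, ?_⟩
  intro B₁ B₂ h12 h2K
  have main := oneCopyDrift_of_relativeDriftPotential (β := 1 / 6) (ρ := μb * c / (96 * (h + 2 * t))) (by norm_num) (by norm_num) hρ hm hqdpos hqu0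
    hqdmono hqd2 hqumono hquK hg0 hga hB0 hB0K hmB0 hmB1 hSlo hSmid hφS hφ0 Q0 hB0Bp Q2a Q2b Q2c (B₁ : ℤ) (B₂ : ℤ)
    (by positivity) (by exact_mod_cast h12) (by exact_mod_cast h2K)
  simp only [Int.floor_sub_one, Int.floor_add_one, Int.floor_natCast]
  simp only [hm, hqd, hqu] at main
  simp only [hπb, hπb']
  push_cast at main ⊢
  linarith [main]

/-! ## §2 The cold-start law in the macroscopic-pool regime -/

section Law
open Finset Function Matrix
open Literature.Probability.MarkovChains

variable {K m : ℕ} {μ : Fin (K + 1) → Bool → ℝ} {M : Fin (K + 1) → Bool → Bool → ℝ} {w : Fin (K + 1) → ℝ} {t : ℝ}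
variable (κ : Fin m → Fin K)

/-- **THE COLD-START LAW IN THE MACROSCOPIC-POOL REGIME, ALL `K`, THE CONJECTURED ORDER IN EVERY `t/h` REGIME — THE LAST CORNER OF OPEN-MATH ITEM 1 (ii) ON THE
HOMOGENEOUS BOOLEAN STAR.**  Homogeneous Boolean star (`m ≥ 1` uniform entries, `0 < t < 1`, `w_0 > 0`, positive laws, idle cold levels, exact hot redraws), liked
content `b`, `rr = μ_0(b)μ_1(b̄)/(μ_0(b̄)μ_1(b))`, `h = (1−t)w_0`.  If **`rr ≤ μ_0(b)`** and **`μ_0(b̄)·rr·K ≥ μ_0(b)/2`** (an equilibrium pool of at least half a disliked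
cold level; the weak-return, strong-drift corner of memo §18 included), then **`t_mix(ε) ≤ ⌈(4/(hρ))·log((3eK+1)/ε)⌉₊`, `ρ = μ_0(b)(t/K)/(96(h + 2t))`**, i.e.
`O((K/(μ_0(b)·min{t, h}))·log(K/ε))` — via S11 `boolStar_mixingTime_le_of_oneCopyDrift_int` with the explicit relative-drift potential of T1 (`oneCopyDrift_macroPool`).
[ours] -/
theorem boolStar_mixingTime_le_macroPool (hm : 1 ≤ m) (ht0 : 0 < t) (ht1 : t < 1) (hw0 : ∀ k, 0 ≤ w k) (hw00 : 0 < w 0)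
    (hw1 : ∑ k, w k = 1) (hμ : ∀ k x, 0 < μ k x) (hμ1 : ∀ k, ∑ u, μ k u = 1) (hM0 : ∀ u v, M 0 u v = μ 0 v)
    (hidle : ∀ i : Fin K, ∀ u v, M i.succ u v = if v = u then 1 else 0) (hhom : ∀ i : Fin K, μ i.succ = μ 1)
    {c0 : ℕ} (hunif : ∀ i : Fin K, (univ.filter fun r : Fin m => κ r = i).card = c0)
    {b : Bool} (hb : μ 0 b * μ 1 (!b) ≤ μ 0 (!b) * μ 1 b)
    (hrrμ : μ 0 b * μ 1 (!b) / (μ 0 (!b) * μ 1 b) ≤ μ 0 b) (hpool : μ 0 b / 2 ≤ μ 0 (!b) * (μ 0 b * μ 1 (!b) / (μ 0 (!b) * μ 1 b)) * K)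
    {ε : ℝ} (hε : 0 < ε) :
    mixingTime (fun y z : Fin (K + 1) → Bool =>
        t * ptGraphSwap μ (fun r : Fin m => (((0 : Fin (K + 1)), (κ r).succ) : Fin (K + 1) × Fin (K + 1))) (fun _ : Fin m => Equiv.refl Bool) y z
          + (1 - t) * prodKernel w M y z) (tensorFun μ) ε
      ≤ ⌈1 / ((1 - t) * w 0 * (μ 0 b * (t / K) / (96 * ((1 - t) * w 0 + 2 * t))) / 4) * Real.log ((Real.exp 1 * (K + 2 * K) + 1) / ε)⌉₊ := by
  let rr : ℝ := μ 0 b * μ 1 (!b) / (μ 0 (!b) * μ 1 b)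
  let πb : ℝ → ℝ := fun B => t / K * B / ((1 - t) * w 0 + t / K * B + t / K * rr * (K - B + 1))
  let πb' : ℝ → ℝ := fun B => t / K * (K - B) * rr / ((1 - t) * w 0 + t / K * (K - B) * rr + t / K * (B + 1))
  have hmK : (m : ℝ) = c0 * K := uniformList_card κ hunif
  have hK1n : 1 ≤ K := by
    have hK0 : K ≠ 0 := by
      intro h0; have : (m : ℝ) = 0 := by rw [hmK, h0]; simp
      exact absurd (by exact_mod_cast this : m = 0) (by omega)
    exact Nat.one_le_iff_ne_zero.mpr hK0
  have hK1 : (1 : ℝ) ≤ K := by exact_mod_cast hK1n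
  obtain ⟨-, hrr0, hrr1⟩ := boolStar_acc_disliked (acc := fun u v => min 1 (μ 0 v * μ 1 u / (μ 0 u * μ 1 v))) hμ (fun u v => rfl) hb (rr := rr) rfl
  have hh0 : 0 < (1 - t) * w 0 := mul_pos (by linarith) hw00
  have hc0 : 0 < t / K := div_pos ht0 (by linarith)
  have hct : t / K ≤ t := div_le_self ht0.le hK1
  have htK : t = t / K * K := by field_simp
  have hsum : μ 0 b + μ 0 (!b) = 1 := by
    have := hμ1 0; rw [Fintype.sum_bool] at this; cases b <;> simp <;> linarith
  have hS : 0 < (1 - t) * w 0 + 2 * t := by linarith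
  have hρ0 : 0 < μ 0 b * (t / K) / (96 * ((1 - t) * w 0 + 2 * t)) := div_pos (mul_pos (hμ 0 b) hc0) (by linarith)
  have hρ1 : μ 0 b * (t / K) / (96 * ((1 - t) * w 0 + 2 * t)) ≤ 1 := by
    rw [div_le_one (by linarith)]
    have h1 : μ 0 b ≤ 1 := by linarith [hμ 0 (!b)]
    have : μ 0 b * (t / K) ≤ 1 * t := by gcongr
    linarith
  obtain ⟨φ, hφ0, hφ, hφm, h1D⟩ := oneCopyDrift_macroPool (πb := πb) (πb' := πb') hh0 hc0 hct htK hK1n hrr0 hrr1 (hμ 0 b) (hμ 0 (!b)).le hsum hrrμ hpool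
    (fun B => rfl) (fun B => rfl)
  exact boolStar_mixingTime_le_of_oneCopyDrift_int κ hm ht0 ht1 hw0 hw00 hw1 hμ hμ1 hM0 hidle hhom hunif hb (rr := rr) rfl hφ0 hφ hφm
    (πb := πb) (πb' := πb') (fun B => rfl) (fun B => rfl) hρ0 hρ1 (fun B₁ B₂ h12 h2K => h1D B₁ B₂ h12 h2K) hε

end Law

end Summit.Ventures.LatticeQCDFlow.Scaling

end
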